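import Literature.Computability.AlgebraicComplexity.ChowReciprocity
import Literature.Computability.AlgebraicComplexity.ChowHadamardHowePullback
import Literature.Computability.AlgebraicComplexity.ChowMultiplicityImageRank
import Literature.Computability.AlgebraicComplexity.ChowPolarization
import Literature.Computability.AlgebraicComplexity.ChowTransposeIdentity
import HarnessLib

/-!
# Chow reciprocity `mult_χ ℂ[Ch_N^n]_d = mult_χ ℂ[Ch_N^d]_n` — discharge of `chowReciprocity`
# (programme #6, Tier B assembly)

Topic `Literature/Computability/AlgebraicComplexity` (cell `val-lit`, programme #6; lead-bip g6 RULINGS #36 (1) /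
#37: assembly owner x3 g4 on the architect's (t04 g6) POSITIVITY-SQUEEZE design, 2026-08-27 05:21Z).
Theorem-only file: no definitions, no named facts. It proves the named fact `chowReciprocity`
(`ChowReciprocity.lean`, Landsberg 2017 Thm. 9.1.1.4 + Ex. 9.1.2.1) from the programme's bricks:

* B2 (`ChowMultiplicityImageRank`, t01 g5): `mult_χ k[Ch_N^n] = dim_k h_n(HWV_χ(k[Sym^n]))` for the
  Hermite–Hadamard–Howe comorphism `h_n = ChowReciprocity.hadamardHowe N n` (Hadamard's kernel theorem);
* A1 (`ChowHadamardHowePullback`, t10 g6): equivariance `hadamardHowe_coordRep`, form symmetry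
  `rename_formPerm_hadamardHowe`, form degrees `formDegree_hadamardHowe`, base change `map_hadamardHowe`;
* A2 (`ChowPolarization`, t14 g6): the polarisation `ι_{n→d} = polarize N n d` is injective on forms of degree
  `d`, onto the form-symmetric polynomials of form degrees `(n,…,n)`, and reflects highest-weight vectors;
* A3 (`ChowTransposeIdentity`, t08 g6): the transpose identity
  `(n!)^d d! ⟪h_n F, ι_{d→n} G⟫ = (d!)^n n! ⟪ι_{n→d} F, h_d G⟫` (Hadamard–Howe self-duality, Landsberg Ex. 9.1.2.1).

## The squeeze (architect t04 g6; no transpose-dual representation theory, no choice functions)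

Fix `N`, `n, d ≥ 1` and a weight `χ` with `|χ| = -n d`; put `X := HWV_χ(ℂ[Sym^n ℂ^N])` (forms of degree `d`,
"a weight pins the degree") and `Y := HWV_χ(ℂ[Sym^d ℂ^N])` (forms of degree `n`).
(S1) For `G ∈ Y`, `p' := h_d G` is form-symmetric of form degrees `(n,…,n)` (A1), hence `p' = ι_{n→d} F₀`
with `F₀` of degree `d` (A2), and `F₀ ∈ X` (A2 reflects highest-weight vectors, A1 equivariance). So
`h_d(Y) ⊆ ι_{n→d}(X₁)` for `X₁ := X ∩ ι_{n→d}⁻¹(h_d(Y))`.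
(S2) `h_n` is injective on `X₁`: if `F ∈ X₁`, `ι F = h_d G`, `h_n F = 0`, then A3 at `(F, Ḡ)` — `Ḡ` the
coefficientwise complex conjugate, still a form of degree `n` (no conjugation-stability of `Y` is needed) —
gives `(d!)^n n! ⟪p', p̄'⟫ = (n!)^d d! ⟪h_n F, ι Ḡ⟫ = 0` because `h_d Ḡ = \overline{h_d G}` (integral structure
constants, `map_hadamardHowe`); and `⟪p, p̄⟫ = Σ_a a!·|p_a|² = 0` forces `p' = 0`, so `ι F = 0`, so `F = 0` (A2).
(S3) Hence `dim h_d(Y) ≤ dim ι(X₁) ≤ dim X₁ = dim h_n(X₁) ≤ dim h_n(X)`; by symmetry `(n,d) ↔ (d,n)` equality;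
(S4) B2 on both sides gives `chowReciprocity_holds`.

Honest framing: classical invariant theory (Hermite 1854 / Hadamard 1897 / Howe) serving DIP 2020's toy
separation `Ch_4^7`; typed ≠ endorsed; nothing here bears on `VP ≠ VNP`, which is NOT proved.

## References

* J. M. Landsberg, *Geometry and Complexity Theory*, CUP 2017, §9.1.1 (Def. 9.1.1.1, Thm. 9.1.1.4 Hadamard),
  Ex. 9.1.2.1 (`h_{d,n}ᵀ = h_{n,d}`), Thm. 9.1.2.5 (Hermite reciprocity). [Landsberg2017]
* J. Dörfler, C. Ikenmeyer, G. Panova, *On geometric complexity theory: multiplicity obstructions are stronger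
  than occurrence obstructions*, SIAM J. Appl. Algebra Geom. 4 (2020), §5. [DorflerIkenmeyerPanova2020]

## Mathlib and tree

Mathlib: `Submodule.finrank_mono`, `Submodule.finrank_map_le`, `LinearMap.finrank_range_of_inj`,
`LinearMap.range_domRestrict`, `Complex.mul_conj`, `Complex.normSq_eq_zero`, `Finset.sum_eq_zero_iff_of_nonneg`.
Tree: `chowReciprocity` (`ChowReciprocity`); `ChowReciprocity.hadamardHowe`, `polarize`, `formSubst`,
`apolarPairing` (`ChowReciprocityDefs`); `hadamardHowe_coordRep`, `formSubst_hadamardHowe_of_mem_highestWeightSpace`,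
`rename_formPerm_hadamardHowe`, `formDegree_hadamardHowe`, `map_hadamardHowe` (`ChowHadamardHowePullback`);
`coordRingMultiplicity_chowSet_eq_finrank_map_genericChow` (`ChowMultiplicityImageRank`);
`eq_zero_of_polarize_eq_zero`, `exists_polarize_eq`, `mem_highestWeightSpace_of_polarize` (`ChowPolarization`, brick A2);
`transpose_identity` (`ChowTransposeIdentity`, brick A3);
`isHomogeneous_of_mem_highestWeightSpace` (`PlethysmLifting`); `finiteDimensional_highestWeightSpace_coordRep_holds`
(`SchurWeylPlethysmOrbitWeightsProofs`); `highestWeightSpace`, `Weight.size` (`GLHighestWeight`).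
-/

noncomputable section

open MvPolynomial Module

namespace Literature.Computability.AlgebraicComplexity

namespace ChowReciprocity

open Literature.NumberTheory.DiophantineGeometry

/-! ### The apolar pairing: `⟪0, q⟫ = 0` and positivity of `⟪p, p̄⟫` over `ℂ` -/

section Apolar

variable {k : Type} [Field k] {σ : Type*}

/-- `⟪0, q⟫ = 0` (the pairing sums over the support of the left argument).
[cite: Landsberg2017, Ex. 9.1.2.1 (§9.1.2)] -/
private theorem apolarPairing_zero_left_aux (q : MvPolynomial σ k) :
    apolarPairing (0 : MvPolynomial σ k) q = 0 := by
  simp [apolarPairing]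

/-- **Positivity of the apolar pairing against the complex conjugate**: `⟪p, p̄⟫ = Σ_a a!·|p_a|²`, so
`⟪p, p̄⟫ = 0` forces `p = 0` (`p̄ = map conj p`, coefficientwise conjugation). This is the step that needs
the ground field `ℂ` (over a general field of characteristic `0` the symmetric pairing has isotropic vectors).
[cite: Landsberg2017, Ex. 9.1.2.1 (§9.1.2)] -/
theorem eq_zero_of_apolarPairing_self_conj_eq_zero {p : MvPolynomial σ ℂ}
    (h : apolarPairing p (MvPolynomial.map (starRingEnd ℂ) p) = 0) : p = 0 := by
  classical
  set Wr : (σ →₀ ℕ) → ℝ := fun a => a.prod fun _ m => (m.factorial : ℝ) with hWr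
  have hWr_pos : ∀ a, 0 < Wr a := fun a =>
    Finset.prod_pos fun i _ => by dsimp only; exact_mod_cast Nat.factorial_pos _
  have hterm : ∀ a : σ →₀ ℕ,
      ((a.prod fun _ m => (m.factorial : ℂ)) * coeff a p) * coeff a (MvPolynomial.map (starRingEnd ℂ) p) =
        ((Wr a * Complex.normSq (coeff a p) : ℝ) : ℂ) := by
    intro a
    rw [coeff_map, mul_assoc, Complex.mul_conj, Complex.ofReal_mul]
    congr 1
    simp only [hWr, Finsupp.prod, Complex.ofReal_prod, Complex.ofReal_natCast]
  have hsum : apolarPairing p (MvPolynomial.map (starRingEnd ℂ) p) =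
      ((∑ a ∈ p.support, Wr a * Complex.normSq (coeff a p) : ℝ) : ℂ) := by
    rw [apolarPairing, Complex.ofReal_sum]
    exact Finset.sum_congr rfl fun a _ => hterm a
  rw [hsum, Complex.ofReal_eq_zero] at h
  have hzero := (Finset.sum_eq_zero_iff_of_nonneg fun a _ =>
    mul_nonneg (hWr_pos a).le (Complex.normSq_nonneg _)).mp h
  by_contra hp
  obtain ⟨a, ha⟩ := support_nonempty.mpr hp
  rcases mul_eq_zero.mp (hzero a ha) with hW | hnsq
  · exact (hWr_pos a).ne' hW
  · exact (mem_support_iff.mp ha) (Complex.normSq_eq_zero.mp hnsq)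

end Apolar

/-! ### The squeeze -/

section Squeeze

variable {N n d : ℕ}

/-- **(S1)** For `G ∈ HWV_χ(k[Sym^d k^N])` (a form of degree `n` when `|χ| = -d n`), `h_d G = ι_{n→d} F₀` for some
`F₀ ∈ HWV_χ(k[Sym^n k^N])` of degree `d`: `h_d G` is form-symmetric of form degrees `(n,…,n)` (A1), so it is a
polarisation (A2.3), of a highest-weight vector because `ι` reflects them (A2.4) and `h` is equivariant (A1.3) —
the first half of the architect's A4. Any field of characteristic `0`.
[cite: Landsberg2017, §9.1.1–9.1.2 (Thm. 9.1.1.4, Ex. 9.1.2.1)] -/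
theorem exists_mem_highestWeightSpace_polarize_eq_hadamardHowe {k : Type} [Field k] [CharZero k] (hd : d ≠ 0)
    {χ : Weight (Fin N)} (hχ : χ.size = -((d * n : ℕ) : ℤ)) {G : MvPolynomial (DegIdx (Fin N) d) k}
    (hG : G ∈ highestWeightSpace (coordRep (Fin N) k d) χ) :
    ∃ F₀ ∈ highestWeightSpace (coordRep (Fin N) k n) χ,
      F₀.IsHomogeneous d ∧ polarize N n d F₀ = hadamardHowe N d G := by
  haveI : Infinite k := CharZero.infinite k
  have hGhom : G.IsHomogeneous n := isHomogeneous_of_mem_highestWeightSpace hd hG hχ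
  obtain ⟨F₀, hF₀, hι⟩ := exists_polarize_eq (k := k) (N := N) (n := n) (d := d)
    (hadamardHowe N d G) (fun π => rename_formPerm_hadamardHowe N d π G)
    (fun a ha kk => formDegree_hadamardHowe N d hGhom ha kk)
  refine ⟨F₀, ?_, hF₀, hι⟩
  refine mem_highestWeightSpace_of_polarize χ hF₀ fun g hg => ?_
  rw [hι]
  exact formSubst_hadamardHowe_of_mem_highestWeightSpace N d hG hg

/-- **(S2)** Over `ℂ`: if `F` (degree `d`) and `G` (degree `n`) have `ι_{n→d} F = h_d G` and `h_n F = 0`, then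
`h_d G = 0` — the transpose identity (A3) at `(F, Ḡ)`, `h_d Ḡ = \overline{h_d G}`, and positivity of `⟪p, p̄⟫`.
[cite: Landsberg2017, Ex. 9.1.2.1 (§9.1.2, self-duality of h_{d,n})] -/
theorem hadamardHowe_eq_zero_of_polarize_eq_of_hadamardHowe_eq_zero {F : MvPolynomial (DegIdx (Fin N) n) ℂ}
    {G : MvPolynomial (DegIdx (Fin N) d) ℂ} (hF : F.IsHomogeneous d) (hG : G.IsHomogeneous n)
    (hι : polarize N n d F = hadamardHowe N d G) (h0 : hadamardHowe N n F = 0) :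
    hadamardHowe N d G = 0 := by
  have hcG : (MvPolynomial.map (starRingEnd ℂ) G).IsHomogeneous n := hG.map _
  have hid := transpose_identity (k := ℂ) hF hcG
  rw [h0, apolarPairing_zero_left_aux, mul_zero, hι, ← map_hadamardHowe] at hid
  have hc : ((d.factorial : ℂ) ^ n * n.factorial) ≠ 0 :=
    mul_ne_zero (pow_ne_zero _ (by exact_mod_cast d.factorial_ne_zero))
      (by exact_mod_cast n.factorial_ne_zero)
  exact eq_zero_of_apolarPairing_self_conj_eq_zero ((mul_eq_zero.mp hid.symm).resolve_left hc)

/-- **(S3) One-sided rank inequality** `dim h_d(HWV_χ(ℂ[Sym^d])) ≤ dim h_n(HWV_χ(ℂ[Sym^n]))` for `n, d ≥ 1`,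
`|χ| = -n d`: with `X₁ := X ∩ ι⁻¹(h_d(Y))`, `h_d(Y) ⊆ ι(X₁)` (S1) and `h_n` is injective on `X₁` (S2 with A2.2),
so `dim h_d(Y) ≤ dim ι(X₁) ≤ dim X₁ = dim h_n(X₁) ≤ dim h_n(X)`.
[cite: Landsberg2017, Ex. 9.1.2.1 (§9.1.2: "h_{d,n} surjective iff h_{n,d} injective")] -/
theorem finrank_map_hadamardHowe_le (hn : n ≠ 0) (hd : d ≠ 0) {χ : Weight (Fin N)}
    (hχ : χ.size = -((n * d : ℕ) : ℤ)) :
    finrank ℂ ↥((highestWeightSpace (coordRep (Fin N) ℂ d) χ).map (hadamardHowe (k := ℂ) N d).toLinearMap) ≤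
      finrank ℂ ↥((highestWeightSpace (coordRep (Fin N) ℂ n) χ).map (hadamardHowe (k := ℂ) N n).toLinearMap) := by
  haveI : Infinite ℂ := CharZero.infinite ℂ
  have hχ' : χ.size = -((d * n : ℕ) : ℤ) := by rwa [mul_comm] at hχ
  set X := highestWeightSpace (coordRep (Fin N) ℂ n) χ with hXdef
  set Y := highestWeightSpace (coordRep (Fin N) ℂ d) χ with hYdef
  set hn' := (hadamardHowe (k := ℂ) N n).toLinearMap with hn'def
  set hd' := (hadamardHowe (k := ℂ) N d).toLinearMap with hd'def
  haveI hXfd : FiniteDimensional ℂ ↥X := finiteDimensional_highestWeightSpace_coordRep_holds hn χ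
  set X₁ : Submodule ℂ (MvPolynomial (DegIdx (Fin N) n) ℂ) := X ⊓ (Y.map hd').comap (polarize N n d)
    with hX₁def
  have hX₁X : X₁ ≤ X := inf_le_left
  haveI hX₁fd : FiniteDimensional ℂ ↥X₁ := Submodule.finiteDimensional_of_le hX₁X
  -- (S1): `h_d(Y) ⊆ ι(X₁)`
  have ha : Y.map hd' ≤ X₁.map (polarize N n d) := by
    intro p hp
    rw [Submodule.mem_map] at hp ⊢
    obtain ⟨G, hG, rfl⟩ := hp
    obtain ⟨F₀, hF₀X, -, hι⟩ := exists_mem_highestWeightSpace_polarize_eq_hadamardHowe (n := n) hd hχ' hG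
    refine ⟨F₀, Submodule.mem_inf.mpr ⟨hF₀X, ?_⟩, hι⟩
    rw [Submodule.mem_comap, hι, Submodule.mem_map]
    exact ⟨G, hG, rfl⟩
  -- (S2): `h_n` is injective on `X₁`
  have hb : ∀ F ∈ X₁, hn' F = 0 → F = 0 := by
    intro F hF h0
    obtain ⟨hFX, hFY⟩ := Submodule.mem_inf.mp hF
    rw [Submodule.mem_comap, Submodule.mem_map] at hFY
    obtain ⟨G, hG, hGF⟩ := hFY
    have hFhom : F.IsHomogeneous d := isHomogeneous_of_mem_highestWeightSpace hn hFX hχ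
    have hGhom : G.IsHomogeneous n := isHomogeneous_of_mem_highestWeightSpace hd hG hχ'
    have hG0 : hadamardHowe N d G = 0 :=
      hadamardHowe_eq_zero_of_polarize_eq_of_hadamardHowe_eq_zero hFhom hGhom hGF.symm h0
    have hpol : polarize N n d F = 0 := by rw [← hGF]; exact hG0
    exact eq_zero_of_polarize_eq_zero hFhom hpol
  have hinj : Function.Injective (hn'.domRestrict X₁) := by
    intro F F' hFF'
    apply Subtype.ext
    rw [← sub_eq_zero]
    refine hb _ (X₁.sub_mem F.2 F'.2) ?_
    rw [map_sub, sub_eq_zero]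
    exact hFF'
  have hrange : finrank ℂ ↥(X₁.map hn') = finrank ℂ ↥X₁ := by
    rw [← LinearMap.range_domRestrict]
    exact LinearMap.finrank_range_of_inj hinj
  haveI : FiniteDimensional ℂ ↥(X.map hn') := inferInstance
  calc finrank ℂ ↥(Y.map hd') ≤ finrank ℂ ↥(X₁.map (polarize N n d)) := Submodule.finrank_mono ha
    _ ≤ finrank ℂ ↥X₁ := Submodule.finrank_map_le _ _
    _ = finrank ℂ ↥(X₁.map hn') := hrange.symm
    _ ≤ finrank ℂ ↥(X.map hn') := Submodule.finrank_mono (Submodule.map_mono hX₁X)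

/-- **Equal ranks**: `dim h_n(HWV_χ(ℂ[Sym^n ℂ^N])) = dim h_d(HWV_χ(ℂ[Sym^d ℂ^N]))` for `n, d ≥ 1`, `|χ| = -n d`
(the one-sided inequality in both orientations). [cite: Landsberg2017, Ex. 9.1.2.1 (§9.1.2)] -/
theorem finrank_map_hadamardHowe_eq (hn : n ≠ 0) (hd : d ≠ 0) {χ : Weight (Fin N)}
    (hχ : χ.size = -((n * d : ℕ) : ℤ)) :
    finrank ℂ ↥((highestWeightSpace (coordRep (Fin N) ℂ n) χ).map (hadamardHowe (k := ℂ) N n).toLinearMap) =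
      finrank ℂ ↥((highestWeightSpace (coordRep (Fin N) ℂ d) χ).map (hadamardHowe (k := ℂ) N d).toLinearMap) :=
  le_antisymm (finrank_map_hadamardHowe_le hd hn (by rwa [mul_comm] at hχ)) (finrank_map_hadamardHowe_le hn hd hχ)

end Squeeze

end ChowReciprocity

/-! ### Discharge -/

open ChowReciprocity in
/-- **Chow reciprocity — DISCHARGE of the named fact `chowReciprocity`**: for all `N`, all `n, d ≥ 1` and every
weight `χ` with `|χ| = -n·d`, `mult_χ(ℂ[Ch_N^n]_d) = mult_χ(ℂ[Ch_N^d]_n)`. Landsberg 2017, Thm. 9.1.1.4 (Hadamard: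
`ker h_{d,n} = I_d(Ch_n)`) with Ex. 9.1.2.1 (`h_{d,n}ᵀ = h_{n,d}`); Hermite reciprocity for `N = 2` (Thm. 9.1.2.5).
Here: B2 on both sides and the rank equality `finrank_map_hadamardHowe_eq`.
[cite: Landsberg2017, Thm. 9.1.1.4 and Exercise 9.1.2.1 (§9.1.1–9.1.2)] -/
theorem chowReciprocity_holds : chowReciprocity := by
  intro N n d χ hn hd hχ
  have hn' : n ≠ 0 := hn.ne'
  have hd' : d ≠ 0 := hd.ne'
  rw [coordRingMultiplicity_chowSet_eq_finrank_map_genericChow N hn' χ,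
    coordRingMultiplicity_chowSet_eq_finrank_map_genericChow N hd' χ]
  exact finrank_map_hadamardHowe_eq hn' hd' hχ

/-! ### Unconditional forms of the transports of `ChowReciprocity.lean` (DIP's parameters `Ch_4^7`) -/

/-- **A reciprocal certificate proves DIP's row — unconditionally**: positivity of `mult_{μ^*}(ℂ[Ch_4^d]_7)`
gives positivity of `mult_{μ^*}(ℂ[Ch_4^7]_d)` (`|μ| = 7d`, `d ≥ 1`); the tree's conditional
`coordRingMultiplicity_chowSet47_pos_of_reciprocal` fed with `chowReciprocity_holds`.
[cite: DorflerIkenmeyerPanova2020, Prop. 5.1 (arXiv p. 12)] [cite: Landsberg2017, Exercise 9.1.2.1 (§9.1.2)] -/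
theorem coordRingMultiplicity_chowSet47_pos_of_reciprocal_holds {μ : Fin 4 → ℕ} {d : ℕ} (hd : 0 < d)
    (hμ : (∑ i, μ i) = 7 * d) (hpos : 0 < coordRingMultiplicity ℂ (chowSet ℂ 4 d) d (rowDual μ)) :
    0 < coordRingMultiplicity ℂ (chowSet ℂ 4 7) 7 (rowDual μ) :=
  coordRingMultiplicity_chowSet47_pos_of_reciprocal chowReciprocity_holds hd hμ hpos

/-- The same over DIP's printed rows `t = (a,b,c,e)` with `a+b+c+e = 7d` — the shape consumed by the residue
assemblies `DIP20_prop_5_1_right_of_residue*` and by the cell's reciprocal certificate files `…47Q…`.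
[cite: DorflerIkenmeyerPanova2020, Prop. 5.1 (arXiv p. 12) and Prop. 7.1 (arXiv p. 16)] -/
theorem coordRingMultiplicity_chowSet47_quadRow_pos_of_reciprocal_holds (t : ℕ × ℕ × ℕ × ℕ) {d : ℕ}
    (hd : 0 < d) (ht : t.1 + t.2.1 + t.2.2.1 + t.2.2.2 = 7 * d)
    (hpos : 0 < coordRingMultiplicity ℂ (chowSet ℂ 4 d) d (rowDual (quadRow t))) :
    0 < coordRingMultiplicity ℂ (chowSet ℂ 4 7) 7 (rowDual (quadRow t)) :=
  coordRingMultiplicity_chowSet47_quadRow_pos_of_reciprocal chowReciprocity_holds t hd ht hpos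

end Literature.Computability.AlgebraicComplexity

end
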